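import Summits.KontsevichZagierPeriods.Zeta5Search.TwoTaleOmega.StepAEFL
import Summits.KontsevichZagierPeriods.Zeta5Search.TwoTaleOmega.StepARKit
import Summits.KontsevichZagierPeriods.Zeta5Search.TwoTaleOmega.StepER

/-!
# (bmiss)@Ω — direction `aef`, SECOND TALE kit: motion along `δ_aef`, the rule box, the telescoped data (cell `pub-zeta5`, cert-2 gen 5)

HONEST FRAMING: systematic search; recurrence certificates; no irrationality claim unless certified. Pure finite algebra over `ℚ`;
no named fact, no `sorry`.

Blueprint `families/tele/RECURRENCE.md` §14.11 (B.2/B.3), on cert-1 g4's templates `StepARKit`/`StepER`/`StepAR`.  Along `δ = aef = (1,0,1,1,0)`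
(lattice variable `u = 2t`): `ε(p+kδ) = (−1)^k ε(p)`, `κ(p+kδ) = (−1)^k κ(p)·∏_{j<k}(e+j)(f−a+e+j)(f+j)` (`kap_addAEF`), and the Γ-ratio
`F_R(p+kδ;u)·(u+a+1)_k·(t+a−b+1)_k·(t+e+f)_{2k} = (−1)^k ∏_{j<k}(e+j)(f−a+e+j)(f+j)·(u+g−b+a)_k (t+f)_k (t+e)_k (t+a)_k·F_R(p;u)`
(`vR_ratio_addAEF`) — the pole range `2·[e, e+f)` MOVES (first direction where it does).  On the aef RULE BOX (`AefBox`: base letters of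
the 81 shapes, `a ≥ 14`, `e,f ≥ a−4`, `max(e,f) ≥ a−2`, `max(a−e,a−f)+1 ≤ b ≤ min(a−e,a−f)+3`, `a+4 ≤ g ≤ a+6`) the ONE certificate shape
`Cert_R = (t+g−1)x_R(t)/((2t+a+1)(t+a−b+1)(t+a−b+2)(t+e+f)⋯(t+e+f+4))` (cert-2 g4 `TwoTaleTelescopeAef*`, written with the redundant common
factors of `cnum/cden`) turns `F_R(p;·)` into closed-form data `GfAEFR X = ofFrac (2·[e,e+f+5) ∪ 2·[a,g−1)) twoRange (NGAEFR X)` with CONSTANT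
polynomial part, the two `(t+a−b+j)` cancelling inside the u-block `(u+a+2…u+g−b+a−1)` (the half-block `eblock(a−b+1,f)` may be empty on
the box).  Here: the box, the atoms of the cleared identity (`IdR`), the data and `GfAEFR_eq_cert`; the step itself is `StepAEFR`.
-/

noncomputable section

open Finset Polynomial
open Literature.NumberTheory.Irrationality.Zudilin2014
open Summit.KontsevichZagierPeriods.Zeta5Search.FormalBarnes
open Summit.KontsevichZagierPeriods.Zeta5Search.Certificates.TwoTaleTelescope

namespace Summit.KontsevichZagierPeriods.Zeta5Search.TwoTaleOmega

namespace Pt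

variable (p : Pt)

/-! ### The aef rule box in base-point letters -/

/-- **The aef rule box** (base point `p` of an aef rule step with target `a ≥ 17`, `TwoTaleOmegaRules.aef_shape` moved by `−3δ`):
`a ≥ 14`, `a−4 ≤ e,f ≤ a`, `max(e,f) ≥ a−2`, `max(a−e,a−f)+1 ≤ b ≤ min(a−e,a−f)+3`, `a+4 ≤ g ≤ a+6`. -/
structure AefBox : Prop where
  /-- `a ≥ 14` -/
  a14 : 14 ≤ p.a
  /-- `e ≥ a − 4` -/
  e_ge : p.a ≤ p.e + 4
  /-- `f ≥ a − 4` -/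
  f_ge : p.a ≤ p.f + 4
  /-- `e ≤ a` -/
  e_le : p.e ≤ p.a
  /-- `f ≤ a` -/
  f_le : p.f ≤ p.a
  /-- `max(e,f) ≥ a − 2` -/
  maxEF : p.a ≤ p.e + 2 ∨ p.a ≤ p.f + 2
  /-- `b ≥ (a−e)+1` -/
  b_ge_e : p.a - p.e + 1 ≤ p.b
  /-- `b ≥ (a−f)+1` -/
  b_ge_f : p.a - p.f + 1 ≤ p.b
  /-- `b ≤ (a−e)+3` -/
  b_le_e : p.b ≤ p.a - p.e + 3
  /-- `b ≤ (a−f)+3` -/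
  b_le_f : p.b ≤ p.a - p.f + 3
  /-- `g ≥ a + 4` -/
  g_ge : p.a + 4 ≤ p.g
  /-- `g ≤ a + 6` -/
  g_le : p.g ≤ p.a + 6

/-! ### Motion along `δ_aef` in the second tale -/

/-- `ε` alternates along `δ_aef`. -/
theorem eps_addAEF (k : ℕ) : (p.addAEF k).eps = (-1) ^ k * p.eps := by
  unfold eps
  rw [neg_one_pow_natAbs, neg_one_pow_natAbs, show (p.addAEF k).a + (p.addAEF k).b + (p.addAEF k).e + (p.addAEF k).f
    = (p.a + p.b + p.e + p.f) + ((3 * k : ℕ) : ℤ) by simp only [addAEF_a, addAEF_b, addAEF_e, addAEF_f]; push_cast; ring,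
    zpow_add₀ (by norm_num), zpow_natCast, pow_mul]
  norm_num
  ring

/-- `κ` along `δ_aef`: `κ(p+kδ) = (−1)^k·∏_{j<k}(e+j)·∏_{j<k}(f−a+e+j)·∏_{j<k}(f+j)·κ(p)` (for `e, f−a+e, f ≥ 1`). -/
theorem kap_addAEF (k : ℕ) (h1 : 0 ≤ p.e - 1) (h2 : 0 ≤ p.f - p.a + p.e - 1) (h3 : 0 ≤ p.f - 1) :
    (p.addAEF k).kap = (-1) ^ k * ((∏ j ∈ range k, ((p.e : ℚ) - 1 + j + 1)) * (∏ j ∈ range k, ((p.f : ℚ) - p.a + p.e - 1 + j + 1))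
      * (∏ j ∈ range k, ((p.f : ℚ) - 1 + j + 1))) * p.kap := by
  have f1 := facZ_add_nat h1 k
  have f2 := facZ_add_nat h2 k
  have f3 := facZ_add_nat h3 k
  unfold kap
  rw [eps_addAEF]
  simp only [addAEF_a, addAEF_b, addAEF_e, addAEF_f, addAEF_g]
  rw [show p.e + (k : ℤ) - 1 = p.e - 1 + k by ring, show p.f + (k : ℤ) - (p.a + k) + (p.e + k) - 1 = p.f - p.a + p.e - 1 + k by ring,
    show p.f + (k : ℤ) - 1 = p.f - 1 + k by ring, f1, f2, f3]
  push_cast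
  ring

variable {p}

/-- **Γ-ratio along `δ_aef`, second tale**: `F_R(p+kδ;u)·block(a+1,a+1+k)(u)·block(a−b+1,a−b+1+k)(u/2)·block(e+f,e+f+2k)(u/2)
 = (−1)^k ∏_{j<k}(e+j)(f−a+e+j)(f+j) · block(g−b+a,g−b+a+k)(u)·block(f,f+k)(u/2)·block(e,e+k)(u/2)·block(a,a+k)(u/2)·F_R(p;u)`. -/
theorem vR_ratio_addAEF (h : p.Omega) (k : ℕ) (hk : (p.addAEF k).Omega) {u : ℚ} (hu : ∀ K ∈ Icc 1 (6 * p.g), u + K ≠ 0) :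
    (p.addAEF k).vR.eval u * ((block (p.a + 1) (p.a + 1 + k)).eval u * (block (p.a - p.b + 1) (p.a - p.b + 1 + k)).eval (u / 2)
      * (block (p.e + p.f) (p.e + p.f + 2 * k)).eval (u / 2))
      = (-1) ^ k * ((∏ j ∈ range k, ((p.e : ℚ) - 1 + j + 1)) * (∏ j ∈ range k, ((p.f : ℚ) - p.a + p.e - 1 + j + 1))
          * (∏ j ∈ range k, ((p.f : ℚ) - 1 + j + 1)))
        * ((block (p.g - p.b + p.a) (p.g - p.b + p.a + k)).eval u * (block p.f (p.f + k)).eval (u / 2)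
          * (block p.e (p.e + k)).eval (u / 2) * (block p.a (p.a + k)).eval (u / 2)) * p.vR.eval u := by
  obtain ⟨o1, o2, o3, o4, o5, o6, o7, o8, o9⟩ := id h
  have hp := h.pos
  have k1 := hk.twoE; have k2 := hk.twoF; have k6 := hk.b_ge; have k7 := hk.a_lt_g; have k3 := hk.e_le; have k4 := hk.f_le
  have k9 := hk.g_le
  simp only [addAEF_a, addAEF_b, addAEF_e, addAEF_f, addAEF_g] at k1 k2 k6 k7 k3 k4 k9
  have hu4 : ∀ K ∈ Icc 1 (4 * p.g), u + K ≠ 0 := fun K hK => hu K (by rw [mem_Icc] at hK ⊢; omega)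
  have hden : (denT p.t2a p.t2b).eval (u / 2) ≠ 0 := denT_ne_zero_Icc h hu4
  have hdenk : (denT (p.addAEF k).t2a (p.addAEF k).t2b).eval (u / 2) ≠ 0 :=
    denT_ne_zero_Icc hk (by simpa using hu4)
  have hkap := kap_addAEF p k (by omega) (by omega) (by omega)
  rw [vR_eval_blocks _ hk.admissibleT hdenk, vR_eval_blocks _ h.admissibleT hden, hkap]
  simp only [addAEF_a, addAEF_b, addAEF_e, addAEF_f, addAEF_g]
  rw [denT_eq, Polynomial.eval_mul] at hden hdenk
  simp only [addAEF_a, addAEF_e, addAEF_f, addAEF_g] at hdenk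
  rw [show p.e + (k : ℤ) + (p.f + k) = p.e + p.f + 2 * k by ring] at hdenk
  rw [show p.a + (k : ℤ) + 1 = p.a + 1 + k by ring, show p.g - p.b + (p.a + (k : ℤ)) = p.g - p.b + p.a + k by ring,
    show p.a + (k : ℤ) - p.b + 1 = p.a - p.b + 1 + k by ring, show p.e + (k : ℤ) + (p.f + k) = p.e + p.f + 2 * k by ring]
  -- block identities: u-block slides up, half-block [a−b+1,f) slides up, den block [e,e+f) grows, den block [a,g) shrinks
  have eB2 : block (p.a + 1) (p.g - p.b + p.a) * block (p.g - p.b + p.a) (p.g - p.b + p.a + k)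
      = block (p.a + 1) (p.a + 1 + k) * block (p.a + 1 + k) (p.g - p.b + p.a + k) := by
    rw [block_mul_block (by omega) (by omega), block_mul_block (by omega) (by omega)]
  have eBh : block (p.a - p.b + 1) p.f * block p.f (p.f + k)
      = block (p.a - p.b + 1) (p.a - p.b + 1 + k) * block (p.a - p.b + 1 + k) (p.f + k) := by
    rw [block_mul_block (by omega) (by omega), block_mul_block (by omega) (by omega)]
  have eDe : block p.e (p.e + k) * block (p.e + k) (p.e + p.f + 2 * k)
      = block p.e (p.e + p.f) * block (p.e + p.f) (p.e + p.f + 2 * k) := by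
    rw [block_mul_block (by omega) (by omega), block_mul_block (by omega) (by omega)]
  have eDa : block p.a p.g = block p.a (p.a + k) * block (p.a + k) p.g := (block_mul_block (by omega) (by omega)).symm
  have eB2' := congrArg (Polynomial.eval u) eB2
  have eBh' := congrArg (Polynomial.eval (u / 2)) eBh
  have eDe' := congrArg (Polynomial.eval (u / 2)) eDe
  simp only [Polynomial.eval_mul] at eB2' eBh' eDe'
  rw [eDa]
  rw [eDa] at hden
  simp only [Polynomial.eval_mul] at hden ⊢
  set B1k := (block (p.a + 1 + ↑k) (p.g - p.b + p.a + ↑k)).eval u with hB1k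
  set Bhk := (block (p.a - p.b + 1 + ↑k) (p.f + ↑k)).eval (u / 2) with hBhk
  set Dek := (block (p.e + ↑k) (p.e + p.f + 2 * ↑k)).eval (u / 2) with hDek
  set Dak := (block (p.a + ↑k) p.g).eval (u / 2) with hDak
  set X1 := (block (p.a + 1) (p.a + 1 + ↑k)).eval u with hX1
  set X2 := (block (p.a - p.b + 1) (p.a - p.b + 1 + ↑k)).eval (u / 2) with hX2
  set X3 := (block (p.e + p.f) (p.e + p.f + 2 * ↑k)).eval (u / 2) with hX3
  set Bg := (block (p.g - p.b + p.a) (p.g - p.b + p.a + ↑k)).eval u with hBg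
  set Bf := (block p.f (p.f + ↑k)).eval (u / 2) with hBf
  set Be := (block p.e (p.e + ↑k)).eval (u / 2) with hBe
  set Ba := (block p.a (p.a + ↑k)).eval (u / 2) with hBa
  set B1 := (block (p.a + 1) (p.g - p.b + p.a)).eval u with hB1
  set Bh := (block (p.a - p.b + 1) p.f).eval (u / 2) with hBh
  set De := (block p.e (p.e + p.f)).eval (u / 2) with hDe
  set P3 : ℚ := (∏ j ∈ range k, ((p.e : ℚ) - 1 + j + 1)) * (∏ j ∈ range k, ((p.f : ℚ) - p.a + p.e - 1 + j + 1))
      * (∏ j ∈ range k, ((p.f : ℚ) - 1 + j + 1)) with hP3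
  have hE : De ≠ 0 := fun h0 => hden (by rw [h0, zero_mul])
  have hEk : Dek ≠ 0 := fun h0 => hdenk (by rw [h0, zero_mul])
  have hDak' : Dak ≠ 0 := fun h0 => hdenk (by rw [h0, mul_zero])
  have hDa0 : Ba ≠ 0 := fun h0 => hden (by rw [h0, zero_mul, mul_zero])
  rw [div_mul_eq_mul_div, mul_div_assoc', div_eq_div_iff (mul_ne_zero hEk hDak') (mul_ne_zero hE (mul_ne_zero hDa0 hDak'))]
  set C := (-1 : ℚ) ^ k * P3 * p.kap with hC
  linear_combination (-(C * Ba * Dak * Bh * Bf * Be * Dek)) * eB2' + (-(C * Ba * Dak * X1 * B1k * Be * Dek)) * eBh'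
    + (-(C * Ba * Dak * X1 * B1k * X2 * Bhk)) * eDe'

/-! ### The atoms of the cleared second-tale identity (shape of `telescope_aef<n>_R`, `t = u/2`) -/

variable (p)

/-- `F_R(p+kδ;u)/F_R(p;u)`, numerator atoms `n_k` (`σ_k = (−1)^k` kept separate): the `t`-free factors `∏_{j<k}(e+j)(f−a+e+j)(f+j)` and
the moving blocks `(u+g−b+a)_k (t+f)_k (t+e)_k (t+a)_k`, written out for `k = 1,2,3`. -/
def numR (k : ℕ) (u : ℚ) : ℚ :=
  if k = 1 then
    (p.e : ℚ) * ((p.f : ℚ) - p.a + p.e) * (p.f : ℚ) * (u + ((p.g : ℚ) - p.b + p.a))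
      * (u / 2 + p.f) * (u / 2 + p.e) * (u / 2 + p.a)
  else if k = 2 then
    (p.e : ℚ) * ((p.e : ℚ) + 1) * (((p.f : ℚ) - p.a + p.e) * ((p.f : ℚ) - p.a + p.e + 1)) * ((p.f : ℚ) * ((p.f : ℚ) + 1))
      * ((u + ((p.g : ℚ) - p.b + p.a)) * (u + ((p.g : ℚ) - p.b + p.a) + 1))
      * ((u / 2 + p.f) * (u / 2 + p.f + 1)) * ((u / 2 + p.e) * (u / 2 + p.e + 1)) * ((u / 2 + p.a) * (u / 2 + p.a + 1))
  else
    (p.e : ℚ) * ((p.e : ℚ) + 1) * ((p.e : ℚ) + 2) * (((p.f : ℚ) - p.a + p.e) * ((p.f : ℚ) - p.a + p.e + 1) * ((p.f : ℚ) - p.a + p.e + 2))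
      * ((p.f : ℚ) * ((p.f : ℚ) + 1) * ((p.f : ℚ) + 2))
      * ((u + ((p.g : ℚ) - p.b + p.a)) * (u + ((p.g : ℚ) - p.b + p.a) + 1) * (u + ((p.g : ℚ) - p.b + p.a) + 2))
      * ((u / 2 + p.f) * (u / 2 + p.f + 1) * (u / 2 + p.f + 2)) * ((u / 2 + p.e) * (u / 2 + p.e + 1) * (u / 2 + p.e + 2))
      * ((u / 2 + p.a) * (u / 2 + p.a + 1) * (u / 2 + p.a + 2))
/-- Denominator atoms `d_k = (u+a+1)_k (t+a−b+1)_k (t+e+f)_{2k}` of the Γ-ratio, written out for `k = 1,2,3`. -/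
def denR (k : ℕ) (u : ℚ) : ℚ :=
  if k = 1 then
    (u + ((p.a : ℚ) + 1)) * (u / 2 + ((p.a : ℚ) - p.b + 1)) * ((u / 2 + ((p.e : ℚ) + p.f)) * (u / 2 + ((p.e : ℚ) + p.f) + 1))
  else if k = 2 then
    (u + ((p.a : ℚ) + 1)) * (u + ((p.a : ℚ) + 1) + 1) * ((u / 2 + ((p.a : ℚ) - p.b + 1)) * (u / 2 + ((p.a : ℚ) - p.b + 1) + 1))
      * ((u / 2 + ((p.e : ℚ) + p.f)) * (u / 2 + ((p.e : ℚ) + p.f) + 1) * (u / 2 + ((p.e : ℚ) + p.f) + 2) * (u / 2 + ((p.e : ℚ) + p.f) + 3))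
  else
    (u + ((p.a : ℚ) + 1)) * (u + ((p.a : ℚ) + 1) + 1) * (u + ((p.a : ℚ) + 1) + 2)
      * ((u / 2 + ((p.a : ℚ) - p.b + 1)) * (u / 2 + ((p.a : ℚ) - p.b + 1) + 1) * (u / 2 + ((p.a : ℚ) - p.b + 1) + 2))
      * ((u / 2 + ((p.e : ℚ) + p.f)) * (u / 2 + ((p.e : ℚ) + p.f) + 1) * (u / 2 + ((p.e : ℚ) + p.f) + 2)
        * (u / 2 + ((p.e : ℚ) + p.f) + 3) * (u / 2 + ((p.e : ℚ) + p.f) + 4) * (u / 2 + ((p.e : ℚ) + p.f) + 5))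
/-- Shift atoms of `vR_shift`: `tn = (u+a−b+g)(u+a−b+g+1)(t+a)(t+e)(t+f)`, `td = (u+a+1)(u+a+2)(t+a−b+1)(t+e+f)(t+g)`. -/
def tnR (u : ℚ) : ℚ :=
  (u + ((p.a : ℚ) - p.b + p.g)) * (u + ((p.a : ℚ) - p.b + p.g) + 1) * (u / 2 + p.a) * (u / 2 + p.e) * (u / 2 + p.f)
/-- See `tnR`. -/
def tdR (u : ℚ) : ℚ :=
  (u + p.a + 1) * (u + p.a + 2) * (u / 2 + ((p.a : ℚ) - p.b + 1)) * (u / 2 + ((p.e : ℚ) + p.f)) * (u / 2 + p.g)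
/-- Certificate numerator atoms `cnum = (t+g−1)(u+a+2)(u+a+3)(t+a−b+3)(t+e+f+5)`. -/
def cnumR (u : ℚ) : ℚ :=
  (u / 2 + ((p.g : ℚ) - 1)) * (u + p.a + 2) * (u + p.a + 3) * (u / 2 + ((p.a : ℚ) - p.b + 3)) * (u / 2 + ((p.e : ℚ) + p.f + 5))
/-- `cnum` shifted by `u ↦ u+2`. -/
def cnumSR (u : ℚ) : ℚ :=
  (u / 2 + p.g) * (u + p.a + 4) * (u + p.a + 5) * (u / 2 + ((p.a : ℚ) - p.b + 4)) * (u / 2 + ((p.e : ℚ) + p.f + 6))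
/-- Certificate denominator atoms `cden = (u+a+1)(t+a−b+1)(t+e+f)(t+e+f+1)(u+a+2)(t+a−b+2)(t+e+f+2)(t+e+f+3)(u+a+3)(t+a−b+3)(t+e+f+4)(t+e+f+5)`. -/
def cdenR (u : ℚ) : ℚ :=
  (u + p.a + 1) * (u / 2 + ((p.a : ℚ) - p.b + 1)) * (u / 2 + ((p.e : ℚ) + p.f)) * (u / 2 + ((p.e : ℚ) + p.f + 1))
    * (u + p.a + 2) * (u / 2 + ((p.a : ℚ) - p.b + 2)) * (u / 2 + ((p.e : ℚ) + p.f + 2)) * (u / 2 + ((p.e : ℚ) + p.f + 3))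
    * (u + p.a + 3) * (u / 2 + ((p.a : ℚ) - p.b + 3)) * (u / 2 + ((p.e : ℚ) + p.f + 4)) * (u / 2 + ((p.e : ℚ) + p.f + 5))
/-- `cden` shifted by `u ↦ u+2`. -/
def cdenSR (u : ℚ) : ℚ :=
  (u + p.a + 3) * (u / 2 + ((p.a : ℚ) - p.b + 2)) * (u / 2 + ((p.e : ℚ) + p.f + 1)) * (u / 2 + ((p.e : ℚ) + p.f + 2))
    * (u + p.a + 4) * (u / 2 + ((p.a : ℚ) - p.b + 3)) * (u / 2 + ((p.e : ℚ) + p.f + 3)) * (u / 2 + ((p.e : ℚ) + p.f + 4))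
    * (u + p.a + 5) * (u / 2 + ((p.a : ℚ) - p.b + 4)) * (u / 2 + ((p.e : ℚ) + p.f + 5)) * (u / 2 + ((p.e : ℚ) + p.f + 6))

/-- **The cleared second-tale telescoping identity of direction `aef`** for the R-side operator `c` and a certificate polynomial `X` in the
lattice variable `u` (`X(u) = x_R(a, u/2)`), at the base point `p`, as a function identity in `u` (`telescope_assembly`'s `hA` with
`σ = (1,−1,1,−1)`). -/
def IdR (c : Fin 4 → ℚ) (X : ℚ[X]) : Prop :=
  ∀ u : ℚ, (c 0 * p.denR 1 u * p.denR 2 u * p.denR 3 u + (-1) * c 1 * p.numR 1 u * p.denR 2 u * p.denR 3 u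
      + 1 * c 2 * p.numR 2 u * p.denR 1 u * p.denR 3 u + (-1) * c 3 * p.numR 3 u * p.denR 1 u * p.denR 2 u)
      * p.cdenSR u * p.tdR u * p.cdenR u
    = (p.cnumSR u * X.eval (u + 2) * p.tnR u * p.cdenR u - p.cnumR u * X.eval u * p.cdenSR u * p.tdR u)
      * (p.denR 1 u * p.denR 2 u * p.denR 3 u)

/-! ### The telescoped function `G = Cert_R · F_R(p;·)` as closed-form data on the rule box -/

/-- Pole range `2·[e, e+f+5)` of `G_{aef,R}` (the five certificate denominators `(t+e+f+j)` extend the range `2·[e,e+f)` of the data). -/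
def AGf : Finset ℤ := (Ico p.e (p.e + p.f + 5)).image (fun i => 2 * i)

/-- Numerator of `G_{aef,R}` on the even lattice: `64κ2^{g−b+1}·[block(a+1,g−b+a)(u) without (u+a+1), (u+2a−2b+2), (u+2a−2b+4)]·
eblock(a−b+1,f)·X` (the three removed factors are the certificate denominators `(2t+a+1)(t+a−b+1)(t+a−b+2)`). -/
def NGAEFR (X : ℚ[X]) : ℚ[X] :=
  C (p.kap * 2 ^ (p.g - p.b + 1).toNat * 64)
    * (block (p.a + 2) (2 * p.a - 2 * p.b + 2) * lin (2 * p.a - 2 * p.b + 3) * block (2 * p.a - 2 * p.b + 5) (p.g - p.b + p.a)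
      * eblock (p.a - p.b + 1) p.f) * X

/-- **The telescoped data** `G_{aef,R}(p)` (poles `2·[e,e+f+5) ∪ 2·[a,g−1)`). -/
def GfAEFR (X : ℚ[X]) : PF := PF.ofFrac (p.AGf ∪ p.BG) (twoRange p.AGf p.BG) (p.NGAEFR X)

/-- The rational certificate `Cert_R(p; u/2) = cnum·X(u)/cden`. -/
def certAEFR (X : ℚ[X]) (u : ℚ) : ℚ := p.cnumR u * X.eval u / p.cdenR u

variable {p}

/-- Membership in `AGf`. -/
theorem mem_AGf {K : ℤ} : K ∈ p.AGf ↔ ∃ i, p.e ≤ i ∧ i < p.e + p.f + 5 ∧ K = 2 * i := by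
  unfold AGf; simp only [mem_image, mem_Ico]
  exact ⟨fun ⟨i, ⟨h1, h2⟩, h3⟩ => ⟨i, h1, h2, h3.symm⟩, fun ⟨i, h1, h2, h3⟩ => ⟨i, ⟨h1, h2⟩, h3.symm⟩⟩

/-- On the box the poles of `G_{aef,R}` lie in `[1, 4g]`. -/
theorem mem_Icc_of_mem_aef (h : p.Omega) (hb : p.AefBox) {K : ℤ} (hK : K ∈ p.AGf ∪ p.BG) : 1 ≤ K ∧ K ≤ 4 * p.g := by
  have := h.pos; have := hb.e_le; have := hb.f_le; have := hb.g_ge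
  rcases mem_union.1 hK with hK | hK
  · obtain ⟨i, h1, h2, rfl⟩ := mem_AGf.1 hK; omega
  · obtain ⟨i, h1, h2, rfl⟩ := mem_BG.1 hK; omega

/-- The polynomial part of `G_{aef,R}` is constant (`deg X ≤ 9`). -/
theorem natDegree_GfAEFR_le (X : ℚ[X]) (hX : X.natDegree ≤ 9) (h : p.Omega) (hb : p.AefBox) :
    (p.GfAEFR X).poly.natDegree ≤ 0 := by
  obtain ⟨o1, o2, o3, o4, o5, o6, o7, o8, o9⟩ := h
  obtain ⟨b1, b2, b3, b4, b5, b6, b7, b8, b9, b10, b11, b12⟩ := hb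
  unfold GfAEFR
  rw [PF.natDegree_ofFrac, sum_twoRange]
  have hN : (p.NGAEFR X).natDegree ≤ ((2 * p.a - 2 * p.b + 2) - (p.a + 2)).toNat + 1 + (p.g - p.b + p.a - (2 * p.a - 2 * p.b + 5)).toNat
      + (p.f - (p.a - p.b + 1)).toNat + 9 := by
    unfold NGAEFR
    refine natDegree_mul_le.trans (Nat.add_le_add ((natDegree_C_mul_le _ _).trans (natDegree_mul_le.trans
      (Nat.add_le_add (natDegree_mul_le.trans (Nat.add_le_add (natDegree_mul_le.trans (Nat.add_le_add ?_ ?_)) ?_)) ?_))) hX)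
    · rw [natDegree_block]
    · unfold lin; rw [natDegree_X_add_C]
    · rw [natDegree_block]
    · rw [natDegree_eblock]
  unfold AGf BG
  rw [card_image_of_injective _ fun x y h => mul_left_cancel₀ two_ne_zero h,
    card_image_of_injective _ fun x y h => mul_left_cancel₀ two_ne_zero h, Int.card_Ico, Int.card_Ico]
  omega

/-- Gluing even blocks: `eblock lo mi · eblock mi hi = eblock lo hi`. -/
theorem eblock_mul_eblock {lo mi hi : ℤ} (h₁ : lo ≤ mi) (h₂ : mi ≤ hi) : eblock lo mi * eblock mi hi = eblock lo hi := by
  unfold eblock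
  rw [← prod_union (Ico_disjoint_Ico_consecutive lo mi hi), Ico_union_Ico_eq_Ico h₁ h₂]

/-- Five consecutive even factors. -/
theorem eval_eblock_five (lo : ℤ) (u : ℚ) : (eblock lo (lo + 5)).eval u
    = (u + 2 * lo) * (u + 2 * lo + 2) * (u + 2 * lo + 4) * (u + 2 * lo + 6) * (u + 2 * lo + 8) := by
  have e0 : eblock (lo + 5) (lo + 5) = 1 := by unfold eblock; rw [Ico_self, prod_empty]
  rw [eblock_succ_left (lo := lo) (by omega), eblock_succ_left (lo := lo + 1) (by omega), eblock_succ_left (lo := lo + 1 + 1) (by omega),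
    eblock_succ_left (lo := lo + 1 + 1 + 1) (by omega), eblock_succ_left (lo := lo + 1 + 1 + 1 + 1) (by omega),
    show lo + 1 + 1 + 1 + 1 + 1 = lo + 5 by ring, e0]
  simp only [Polynomial.eval_mul, eval_lin, Polynomial.eval_one]
  push_cast; ring

/-- The REDUCED certificate: `Cert_R(u/2) = 64(u+2g−2)X(u)/((u+a+1)(u+2a−2b+2)(u+2a−2b+4)(u+2e+2f)⋯(u+2e+2f+8))` (the common factors
`(2t+a+2)(2t+a+3)(t+a−b+3)(t+e+f+5)` of `cnum`/`cden` cancelled, halves cleared). -/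
def certRedR (X : ℚ[X]) (u : ℚ) : ℚ :=
  64 * (u + 2 * ((p.g : ℚ) - 1)) * X.eval u
    / ((u + p.a + 1) * (u + 2 * ((p.a : ℚ) - p.b + 1)) * (u + 2 * ((p.a : ℚ) - p.b + 2))
      * ((u + 2 * ((p.e : ℚ) + p.f)) * (u + 2 * ((p.e : ℚ) + p.f) + 2) * (u + 2 * ((p.e : ℚ) + p.f) + 4)
        * (u + 2 * ((p.e : ℚ) + p.f) + 6) * (u + 2 * ((p.e : ℚ) + p.f) + 8)))

/-- Non-vanishing of the lattice factors used below, from `u + K ≠ 0` on `[1, 6g]` (box inequalities). -/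
theorem lattice_ne (h : p.Omega) (hb : p.AefBox) {u : ℚ} (hu : ∀ K ∈ Icc 1 (6 * p.g), u + K ≠ 0) :
    (u + p.a + 1 ≠ 0 ∧ u + p.a + 2 ≠ 0 ∧ u + p.a + 3 ≠ 0 ∧ u + p.a + 4 ≠ 0 ∧ u + p.a + 5 ≠ 0) ∧
    (u + 2 * ((p.a : ℚ) - p.b + 1) ≠ 0 ∧ u + 2 * ((p.a : ℚ) - p.b + 2) ≠ 0 ∧ u + 2 * ((p.a : ℚ) - p.b + 3) ≠ 0 ∧
      u + 2 * ((p.a : ℚ) - p.b + 4) ≠ 0) ∧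
    (u + 2 * ((p.e : ℚ) + p.f) ≠ 0 ∧ u + 2 * ((p.e : ℚ) + p.f) + 2 ≠ 0 ∧ u + 2 * ((p.e : ℚ) + p.f) + 4 ≠ 0 ∧
      u + 2 * ((p.e : ℚ) + p.f) + 6 ≠ 0 ∧ u + 2 * ((p.e : ℚ) + p.f) + 8 ≠ 0 ∧ u + 2 * ((p.e : ℚ) + p.f) + 10 ≠ 0 ∧
      u + 2 * ((p.e : ℚ) + p.f) + 12 ≠ 0) ∧
    (u + 2 * ((p.g : ℚ) - 1) ≠ 0 ∧ u + 2 * (p.g : ℚ) ≠ 0) := by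
  obtain ⟨o1, o2, o3, o4, o5, o6, o7, o8, o9⟩ := h
  obtain ⟨b1, b2, b3, b4, b5, b6, b7, b8, b9, b10, b11, b12⟩ := hb
  have nz : ∀ K : ℤ, 1 ≤ K → K ≤ 6 * p.g → u + (K : ℚ) ≠ 0 := fun K h1 h2 => hu K (mem_Icc.2 ⟨h1, h2⟩)
  refine ⟨⟨?_, ?_, ?_, ?_, ?_⟩, ⟨?_, ?_, ?_, ?_⟩, ⟨?_, ?_, ?_, ?_, ?_, ?_, ?_⟩, ⟨?_, ?_⟩⟩
  · have := nz (p.a + 1) (by omega) (by omega); push_cast at this; rwa [add_assoc]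
  · have := nz (p.a + 2) (by omega) (by omega); push_cast at this; rwa [add_assoc]
  · have := nz (p.a + 3) (by omega) (by omega); push_cast at this; rwa [add_assoc]
  · have := nz (p.a + 4) (by omega) (by omega); push_cast at this; rwa [add_assoc]
  · have := nz (p.a + 5) (by omega) (by omega); push_cast at this; rwa [add_assoc]
  · have := nz (2 * (p.a - p.b + 1)) (by omega) (by omega); push_cast at this; exact this
  · have := nz (2 * (p.a - p.b + 2)) (by omega) (by omega); push_cast at this; exact this
  · have := nz (2 * (p.a - p.b + 3)) (by omega) (by omega); push_cast at this; exact this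
  · have := nz (2 * (p.a - p.b + 4)) (by omega) (by omega); push_cast at this; exact this
  · have := nz (2 * (p.e + p.f)) (by omega) (by omega); push_cast at this; exact this
  · have := nz (2 * (p.e + p.f) + 2) (by omega) (by omega); push_cast at this; rwa [add_assoc] 
  · have := nz (2 * (p.e + p.f) + 4) (by omega) (by omega); push_cast at this; rwa [add_assoc]
  · have := nz (2 * (p.e + p.f) + 6) (by omega) (by omega); push_cast at this; rwa [add_assoc]
  · have := nz (2 * (p.e + p.f) + 8) (by omega) (by omega); push_cast at this; rwa [add_assoc]
  · have := nz (2 * (p.e + p.f) + 10) (by omega) (by omega); push_cast at this; rwa [add_assoc]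
  · have := nz (2 * (p.e + p.f) + 12) (by omega) (by omega); push_cast at this; rwa [add_assoc]
  · have := nz (2 * (p.g - 1)) (by omega) (by omega); push_cast at this; exact this
  · have := nz (2 * p.g) (by omega) (by omega); push_cast at this; exact this

/-- `Cert_R = reduced Cert_R` off the lattice. -/
theorem certAEFR_eq_red (X : ℚ[X]) (h : p.Omega) (hb : p.AefBox) {u : ℚ} (hu : ∀ K ∈ Icc 1 (6 * p.g), u + K ≠ 0) :
    p.certAEFR X u = p.certRedR X u := by
  obtain ⟨⟨a1, a2, a3, -, -⟩, ⟨c1, c2, c3, -⟩, ⟨e0, e1, e2, e3, e4, e5, -⟩, -⟩ := lattice_ne h hb hu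
  unfold certAEFR certRedR cnumR cdenR
  rw [show u / 2 + ((p.g : ℚ) - 1) = (u + 2 * ((p.g : ℚ) - 1)) / 2 by ring,
    show u / 2 + ((p.a : ℚ) - p.b + 1) = (u + 2 * ((p.a : ℚ) - p.b + 1)) / 2 by ring,
    show u / 2 + ((p.a : ℚ) - p.b + 2) = (u + 2 * ((p.a : ℚ) - p.b + 2)) / 2 by ring,
    show u / 2 + ((p.a : ℚ) - p.b + 3) = (u + 2 * ((p.a : ℚ) - p.b + 3)) / 2 by ring,
    show u / 2 + ((p.e : ℚ) + p.f) = (u + 2 * ((p.e : ℚ) + p.f)) / 2 by ring,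
    show u / 2 + ((p.e : ℚ) + p.f + 1) = (u + 2 * ((p.e : ℚ) + p.f) + 2) / 2 by ring,
    show u / 2 + ((p.e : ℚ) + p.f + 2) = (u + 2 * ((p.e : ℚ) + p.f) + 4) / 2 by ring,
    show u / 2 + ((p.e : ℚ) + p.f + 3) = (u + 2 * ((p.e : ℚ) + p.f) + 6) / 2 by ring,
    show u / 2 + ((p.e : ℚ) + p.f + 4) = (u + 2 * ((p.e : ℚ) + p.f) + 8) / 2 by ring,
    show u / 2 + ((p.e : ℚ) + p.f + 5) = (u + 2 * ((p.e : ℚ) + p.f) + 10) / 2 by ring]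
  field_simp
  ring

/-- **`G = Cert_R · F_R`** on the box: off the lattice interval `[1, 6g]`, `G_{aef,R}(u) = Cert_R(u/2)·vR(p)(u)`. -/
theorem GfAEFR_eq_cert (X : ℚ[X]) (h : p.Omega) (hb : p.AefBox) {u : ℚ} (hu : ∀ K ∈ Icc 1 (6 * p.g), u + K ≠ 0) :
    (p.GfAEFR X).eval u = p.certAEFR X u * p.vR.eval u := by
  have hp := h.pos
  obtain ⟨⟨a1, a2, a3, -, -⟩, ⟨c1, c2, c3, -⟩, ⟨e0, e1, e2, e3, e4, -, -⟩, ⟨g1, -⟩⟩ := lattice_ne h hb hu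
  obtain ⟨o1, o2, o3, o4, o5, o6, o7, o8, o9⟩ := id h
  obtain ⟨b1, b2, b3, b4, b5, b6, b7, b8, b9, b10, b11, b12⟩ := id hb
  have hu4 : ∀ K ∈ Icc 1 (4 * p.g), u + K ≠ 0 := fun K hK => hu K (by rw [mem_Icc] at hK ⊢; omega)
  have huG : ∀ K ∈ p.AGf ∪ p.BG, u + K ≠ 0 := fun K hK => hu4 K (mem_Icc.2 (mem_Icc_of_mem_aef h hb hK))
  have huR : ∀ K ∈ p.AR ∪ p.BR, u + K ≠ 0 := fun K hK => hu4 K (mem_Icc.2 (mem_Icc_of_mem h (Or.inr hK)))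
  rw [certAEFR_eq_red X h hb hu, vR_eq_ofFrac h]
  unfold GfAEFR certRedR
  rw [PF.eval_ofFrac _ _ _ (fun _ hk => twoRange_mem hk) huG, PF.eval_ofFrac _ _ _ (fun _ hk => twoRange_mem hk) huR,
    denom_twoRange, denom_twoRange]
  unfold AGf BG AR BR NGAEFR NR
  rw [← eblock_eq_prod_image, ← eblock_eq_prod_image, ← eblock_eq_prod_image, ← eblock_eq_prod_image]
  -- split block(a+1, g−b+a) = (u+a+1)·block(a+2, 2a−2b+2)·(u+2a−2b+2)(u+2a−2b+3)(u+2a−2b+4)·block(2a−2b+5, g−b+a)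
  rw [block_succ_left (lo := p.a + 1) (hi := p.g - p.b + p.a) (by omega), show p.a + 1 + 1 = p.a + 2 by ring,
    ← block_mul_block (lo := p.a + 2) (mi := 2 * p.a - 2 * p.b + 2) (hi := p.g - p.b + p.a) (by omega) (by omega),
    block_succ_left (lo := 2 * p.a - 2 * p.b + 2) (hi := p.g - p.b + p.a) (by omega),
    block_succ_left (lo := 2 * p.a - 2 * p.b + 2 + 1) (hi := p.g - p.b + p.a) (by omega),
    block_succ_left (lo := 2 * p.a - 2 * p.b + 2 + 1 + 1) (hi := p.g - p.b + p.a) (by omega),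
    show 2 * p.a - 2 * p.b + 2 + 1 + 1 + 1 = 2 * p.a - 2 * p.b + 5 by ring, show 2 * p.a - 2 * p.b + 2 + 1 + 1 = 2 * p.a - 2 * p.b + 4 by ring,
    show 2 * p.a - 2 * p.b + 2 + 1 = 2 * p.a - 2 * p.b + 3 by ring,
    ← eblock_mul_eblock (lo := p.e) (mi := p.e + p.f) (hi := p.e + p.f + 5) (by omega) (by omega),
    show p.g = (p.g - 1) + 1 by ring, eblock_succ_right (lo := p.a) (hi := p.g - 1) (by omega)]
  simp only [show p.g - 1 + 1 = p.g by ring]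
  simp only [Polynomial.eval_mul, Polynomial.eval_C, eval_lin]
  rw [eval_eblock_five]
  have nz : ∀ K : ℤ, 1 ≤ K → K ≤ 6 * p.g → u + (K : ℚ) ≠ 0 := fun K h1 h2 => hu K (mem_Icc.2 ⟨h1, h2⟩)
  have hDe : (eblock p.e (p.e + p.f)).eval u ≠ 0 := by
    rw [eval_eblock]; exact prod_ne_zero_iff.2 fun i hi heq => nz (2 * i) (by rw [mem_Ico] at hi; omega)
      (by rw [mem_Ico] at hi; omega) (by push_cast; exact heq)
  have hDa : (eblock p.a (p.g - 1)).eval u ≠ 0 := by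
    rw [eval_eblock]; exact prod_ne_zero_iff.2 fun i hi heq => nz (2 * i) (by rw [mem_Ico] at hi; omega)
      (by rw [mem_Ico] at hi; omega) (by push_cast; exact heq)
  have i1 : u + ((2 * p.a - 2 * p.b + 2 : ℤ) : ℚ) ≠ 0 := by push_cast; convert c1 using 1; ring
  have i2 : u + ((2 * p.a - 2 * p.b + 4 : ℤ) : ℚ) ≠ 0 := by push_cast; convert c2 using 1; ring
  push_cast at i1 i2 ⊢
  field_simp
  ring

end Pt

end Summit.KontsevichZagierPeriods.Zeta5Search.TwoTaleOmega

end
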